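import Summits.Ventures.HodgeRepro2.T5SU11BorelHaarNA

/-!
# The Haar measure of `SU(1,1) = B K` as `db dk`: `ν = ((b, k) ↦ b k)_* (borelHaar ⊗ μ_K)`

`SU(1,1) = B · K` with `B = A N` the Borel subgroup and `K` the rotation subgroup, uniquely
(`T5SU11Iwasawa`, `T5SU11IwasawaUnique`). The Haar measure `ν = Φ_*(poincare ⊗ μ_K)` of
`T5SU11FibrationHaar` is `Ψ_*(e^{-2t} ds dt ⊗ μ_K)` under the Iwasawa map `Ψ(ζ, k) = n_s a_t k`
(`T5SU11IwasawaMeasure`), and `e^{-2t} ds dt` is the left Haar measure of `B` in the chart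
`ζ ↦ n_s a_t` (`T5SU11BorelHaarNA`). Hence, with `mulBK (b, k) = b · k`,
**`ν = (mulBK)_* (borelHaar ⊗ μ_K)`** (`nu_eq_map_mulBK`): `dg = db dk` for `g = b k` — the
classical decomposition of the Haar measure of a unimodular group over `G = B K` with `K` compact
and `db` the LEFT Haar measure of `B`. `mulBK` is a measurable bijection `B × K → SU(1,1)`
(`mulBK_bijective`, `measurableEmbedding_mulBK`), so `∫_G f dν = ∫_{B × K} f(b k) d(borelHaar ⊗ μ_K)`
for EVERY `f` (`integral_nu_mulBK`, `lintegral_nu_mulBK`) and `∫_G f dν = ∫_B ∫_K f(b k) dk db` for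
`ν`-integrable `f` (`integral_nu_iterated`); every Haar measure `μ` of `SU(1,1)` is
`c⁻¹ (mulBK)_* (borelHaar ⊗ μ_K)` with `c = haarScalarFactor ν μ > 0` (`haar_eq_smul_map_mulBK`,
`integral_haar_iterated`). Nothing is claimed about (N).

Blind lane: Mathlib + the HodgeRepro2 prefix only; no sorry; axioms ⊆ {propext, Classical.choice,
Quot.sound}.
-/

namespace Summit.Ventures.HodgeRepro2.T5SU11HaarBK

open MeasureTheory MeasureTheory.Measure Metric Filter Topology Set Complex
open T5UnitaryBound T5PoincareDensity T5PoincareInvariance T5PoincareMeasure T5SU11Unimodular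
  T5SU11Fibration T5SU11FibrationHaar T5SU11Cartan T5SU11OneParameter T5BergmanCoefficient
  T5SU11HyperbolicSubgroup T5SU11UnipotentSubgroup T5SU11BorelSubgroup T5SU11Iwasawa
  T5SU11IwasawaUnique T5SU11BorelTransitive T5SU11IwasawaHaar T5SU11BorelHaar
  T5SU11BorelHaarMeasure T5SU11IwasawaMeasure T5SU11BorelHaarNA
open scoped ENNReal NNReal

/-! ### The `N A` chart as a homeomorphism and the multiplication map `B × K → SU(1,1)` -/

/-- The `N A` chart `ζ ↦ n_s a_t` as a homeomorphism `ℂ ≃ₜ B` (`shear (-2)` followed by the `A N`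
chart homeomorphism of `T5SU11BorelHaarMeasure`). -/
noncomputable def borelHomeomorphNA : ℂ ≃ₜ borelSubgroup :=
  (shearHomeomorph (-2)).trans borelHomeomorph

/-- `borelHomeomorphNA = borelCoordNAB` as functions. -/
lemma coe_borelHomeomorphNA : ⇑borelHomeomorphNA = borelCoordNAB := by
  rw [borelCoordNAB_eq_comp]
  rfl

/-- The multiplication map `B × K → SU(1,1)`, `(b, k) ↦ b · rot k`. -/
noncomputable def mulBK (p : borelSubgroup × Circle) : SU11 := (p.1 : SU11) * rot p.2

/-- `mulBK (b, k) = b · rot k`. -/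
lemma mulBK_apply (b : borelSubgroup) (u : Circle) : mulBK (b, u) = (b : SU11) * rot u := rfl

/-- The Iwasawa map factors through `mulBK`: `Ψ = mulBK ∘ (borelCoordNAB × id)`. -/
lemma iwasawa_eq_mulBK_comp : iwasawa = mulBK ∘ Prod.map borelCoordNAB id :=
  funext fun _ => rfl

/-- `mulBK` is continuous. -/
lemma continuous_mulBK : Continuous mulBK :=
  (continuous_subtype_val.comp continuous_fst).mul (continuous_rot.comp continuous_snd)

/-- `mulBK = Ψ ∘ (borelHomeomorphNA.symm × id)`. -/
lemma mulBK_eq_iwasawa_comp :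
    mulBK = iwasawa ∘ Prod.map (⇑borelHomeomorphNA.symm) id := by
  rw [iwasawa_eq_mulBK_comp, Function.comp_assoc, Prod.map_comp_map, ← coe_borelHomeomorphNA,
    Homeomorph.self_comp_symm, Function.comp_id, Prod.map_id, Function.comp_id]

/-- **`mulBK` is a bijection `B × K → SU(1,1)`**: `SU(1,1) = B K` uniquely. -/
theorem mulBK_bijective : Function.Bijective mulBK := by
  rw [mulBK_eq_iwasawa_comp]
  exact iwasawa_bijective.comp (borelHomeomorphNA.symm.prodCongr (Homeomorph.refl Circle)).bijective

section measure

variable [MeasurableSpace Circle] [BorelSpace Circle]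

/-- The Iwasawa map is a measurable embedding (continuous and injective on the Polish space
`ℂ × K`). -/
lemma measurableEmbedding_iwasawa : MeasurableEmbedding iwasawa :=
  continuous_iwasawa.measurableEmbedding iwasawa_bijective.1

/-- `mulBK` is a measurable embedding `B × K → SU(1,1)`. -/
lemma measurableEmbedding_mulBK : MeasurableEmbedding mulBK := by
  rw [mulBK_eq_iwasawa_comp]
  exact measurableEmbedding_iwasawa.comp
    (borelHomeomorphNA.symm.prodCongr (Homeomorph.refl Circle)).measurableEmbedding

/-- `mulBK` is measurable. -/
lemma measurable_mulBK : Measurable mulBK := continuous_mulBK.measurable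

variable (μC : Measure Circle) [IsHaarMeasure μC]

/-! ### `ν = (mulBK)_* (borelHaar ⊗ μ_K)` -/

/-- **THE HAAR MEASURE OF `SU(1,1) = B K` IS `db dk`**: `ν = (mulBK)_* (borelHaar ⊗ μ_K)`, with
`borelHaar` the left Haar measure of the Borel subgroup and `μ_K` a Haar measure of `K`. -/
theorem nu_eq_map_mulBK : nu μC = Measure.map mulBK (borelHaar.prod μC) := by
  have h := Measure.map_prod_map iwasawaDensity μC measurable_borelCoordNAB
    (measurable_id (α := Circle))
  rw [Measure.map_id] at h
  rw [nu_eq_map_iwasawa, borelHaar_eq_map_NA, h,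
    Measure.map_map measurable_mulBK (measurable_borelCoordNAB.prodMap measurable_id),
    iwasawa_eq_mulBK_comp]

/-- **`∫⁻_G f dν = ∫⁻_{B × K} f(b k) d(borelHaar ⊗ μ_K)`** for EVERY `f`. -/
theorem lintegral_nu_mulBK (f : SU11 → ℝ≥0∞) :
    ∫⁻ g, f g ∂(nu μC) = ∫⁻ p, f (mulBK p) ∂(borelHaar.prod μC) := by
  rw [nu_eq_map_mulBK, measurableEmbedding_mulBK.lintegral_map]

/-- **`∫_G f dν = ∫_{B × K} f(b k) d(borelHaar ⊗ μ_K)`** for EVERY `f` (no integrability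
hypothesis). -/
theorem integral_nu_mulBK {E : Type*} [NormedAddCommGroup E] [NormedSpace ℝ E] (f : SU11 → E) :
    ∫ g, f g ∂(nu μC) = ∫ p, f (mulBK p) ∂(borelHaar.prod μC) := by
  rw [nu_eq_map_mulBK, measurableEmbedding_mulBK.integral_map]

/-- **`∫_G f dν = ∫_B ∫_K f(b k) dk db`** for `ν`-integrable `f` (Fubini over `B × K`). -/
theorem integral_nu_iterated {E : Type*} [NormedAddCommGroup E] [NormedSpace ℝ E] [CompleteSpace E]
    (f : SU11 → E) (hf : Integrable f (nu μC)) :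
    ∫ g, f g ∂(nu μC) = ∫ b, ∫ u, f ((b : SU11) * rot u) ∂μC ∂borelHaar := by
  rw [integral_nu_mulBK]
  have hf' : Integrable (f ∘ mulBK) (borelHaar.prod μC) := by
    rw [← measurableEmbedding_mulBK.integrable_map_iff, ← nu_eq_map_mulBK]
    exact hf
  exact integral_prod (fun p => f (mulBK p)) hf'

/-- **Every Haar measure of `SU(1,1)` is a positive multiple of `(mulBK)_* (borelHaar ⊗ μ_K)`**:
`μ = c⁻¹ • (mulBK)_* (borelHaar ⊗ μ_K)` with `c = haarScalarFactor ν μ > 0`. -/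
theorem haar_eq_smul_map_mulBK (μ : Measure SU11) [IsHaarMeasure μ] :
    μ = ((haarScalarFactor (nu μC) μ : ℝ≥0∞)⁻¹) • Measure.map mulBK (borelHaar.prod μC) := by
  rw [← nu_eq_map_mulBK]
  exact (haar_eq_smul_map_iwasawa μC μ).trans (by rw [← nu_eq_map_iwasawa])

/-- **The Haar measure of `SU(1,1)` over `G = B K`**: for every Haar measure `μ` and every
`μ`-integrable `f`, `c • ∫_G f dμ = ∫_B ∫_K f(b k) dk db` with `c = haarScalarFactor ν μ > 0`. -/
theorem integral_haar_iterated (μ : Measure SU11) [IsHaarMeasure μ] {E : Type*}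
    [NormedAddCommGroup E] [NormedSpace ℝ E] [CompleteSpace E] (f : SU11 → E)
    (hf : Integrable f μ) :
    (haarScalarFactor (nu μC) μ : ℝ) • ∫ g, f g ∂μ =
      ∫ b, ∫ u, f ((b : SU11) * rot u) ∂μC ∂borelHaar := by
  set c := haarScalarFactor (nu μC) μ with hc
  have hnu : nu μC = c • μ := nu_eq_smul μC μ
  have hint : Integrable f (nu μC) := by
    rw [hnu]
    exact hf.smul_measure ENNReal.coe_ne_top
  have h1 : ∫ g, f g ∂(nu μC) = (c : ℝ) • ∫ g, f g ∂μ := by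
    rw [hnu, integral_smul_nnreal_measure, NNReal.smul_def]
  rw [← h1, integral_nu_iterated μC f hint]

end measure

end Summit.Ventures.HodgeRepro2.T5SU11HaarBK
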